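import Mathlib
import Summits.ValiantsHypothesis.ValiantsHypothesis.Theorems.GeneratorObstructionsPowGenDegreeQPGadgetTableauDefs
import Literature.Computability.AlgebraicComplexity.TableauScaling

/-!
# Route GeneratorObstructions — crux K2 `PowGenDegreeQP` (stmt-ValiantsHypothesis-11655), line
# `trace-side-regimes`: the gadget tableau datum is framed (its box map is a bijection)

Companion of `…PowGenDegreeQPGadgetTableauDefs` (`gadgetTab`, `boxColRow`, `boxColRow_lt`).  Here:
`boxColRow` is injective on `Fin d × Fin m` (the row determines block and kind of the letter —
`letterPos_inj`; the column then determines copy and column index; the D*-label is recovered from the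
kind — `tripleLabNat` is a permutation, `pairIdx`/`pairLabNat` are consistent), the diagram has exactly
`d · m = 15k(2^c - 1)` boxes (`sum_colHeight`), hence the box map is a bijection
(`gadgetTab_box_bijective`) and `gadgetTabFrame` is a `TabM.Frame` — the input format of
`TableauEval.TabM.tabPoly_mem_highestWeightSpace` / `exists_hwv_evalAtPoint_ne_zero_of_tabPoly`.

Honest framing: index arithmetic; no stub, crux or summit is settled here; `VP ≠ VNP` untouched.
[folklore]
-/

namespace Summit.ValiantsHypothesis.ValiantsHypothesis.Theorems.GeneratorObstructions.PowGenDegreeQP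

open Literature.Computability.AlgebraicComplexity Literature.Computability.AlgebraicComplexity.TableauEval

-- `Summit.ValiantsHypothesis.ValiantsHypothesis.…` is the tree's mandated single-conjunct layout.
set_option linter.dupNamespace false

noncomputable section

/-! ## §1 Injectivity lemmas -/

/-- Letter positions determine block and kind (blocks `< c`). [folklore] -/
theorem letterPos_inj {c j j' : ℕ} (hj : j < c) (hj' : j' < c) {r r' : Fin 3}
    (h : letterPos c j r = letterPos c j' r') : j = j' ∧ r = r' := by
  unfold letterPos at h
  fin_cases r <;> fin_cases r' <;> simp at h ⊢ <;> (try split_ifs at h) <;> omega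

/-- Rows determine block and kind (blocks `< c`). [folklore] -/
theorem letterRow_inj {c j j' : ℕ} (hj : j < c) (hj' : j' < c) {r r' : Fin 3}
    (h : letterRow c j r = letterRow c j' r') : j = j' ∧ r = r' := by
  have h1 := letterPos_le hj r
  have h2 := letterPos_le hj' r'
  unfold letterRow at h
  exact letterPos_inj hj hj' (by omega)

/-- `pairIdx` is injective in `t < 2k`. [folklore] -/
theorem pairIdx_inj {k t t' : ℕ} (_ht : t < 2 * k) (_ht' : t' < 2 * k) (ℓ : Fin 3)
    (h : pairIdx k ℓ t = pairIdx k ℓ t') : t = t' := by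
  unfold pairIdx at h; split_ifs at h <;> omega

/-- The D*-label `ℓ` occurs in its pair columns: it is one of the two labels of column
`pairIdx k ℓ t`. [folklore] -/
theorem pairLabNat_pairIdx {k t : ℕ} (ht : t < 2 * k) (ℓ : Fin 3) :
    pairLabNat k (pairIdx k ℓ t) 0 = ℓ ∨ pairLabNat k (pairIdx k ℓ t) 1 = ℓ := by
  unfold pairLabNat pairIdx
  fin_cases ℓ <;> simp <;> (split_ifs <;> simp_all <;> omega)

/-- The kind in a pair column determines the label among the column's two labels. [folklore] -/
theorem eq_of_pairKind_eq {k t t' : ℕ} (ht : t < 2 * k) (ht' : t' < 2 * k) {ℓ ℓ' : Fin 3}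
    (hi : pairIdx k ℓ t = pairIdx k ℓ' t')
    (hκ : pairKind k ℓ (pairIdx k ℓ t) = pairKind k ℓ' (pairIdx k ℓ' t')) : ℓ = ℓ' := by
  have h1 := pairLabNat_pairIdx ht ℓ
  have h2 := pairLabNat_pairIdx ht' ℓ'
  rw [← hi] at h2
  unfold pairKind at hκ
  rw [← hi] at hκ
  by_cases ha : pairLabNat k (pairIdx k ℓ t) 0 = ℓ
  · by_cases hb : pairLabNat k (pairIdx k ℓ t) 0 = ℓ'
    · exact ha.symm.trans hb
    · rw [if_pos ha, if_neg hb] at hκ; exact absurd hκ (by decide)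
  · by_cases hb : pairLabNat k (pairIdx k ℓ t) 0 = ℓ'
    · rw [if_neg ha, if_pos hb] at hκ; exact absurd hκ (by decide)
    · rcases h1 with h1 | h1
      · exact absurd h1 ha
      rcases h2 with h2 | h2
      · exact absurd h2 hb
      exact h1.symm.trans h2

/-- A label is determined by its block, copy and D*-label. [folklore] -/
theorem lab_eq_of {c : ℕ} (u u' : Fin (3 * (2 ^ c - 1))) (hb : labBlock u = labBlock u')
    (hq : labCopy u = labCopy u') (hl : labLab u = labLab u') : u = u' := by
  obtain ⟨-, -, h1⟩ := labBlock_lt u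
  obtain ⟨-, -, h2⟩ := labBlock_lt u'
  have hl' : u.val % 3 = u'.val % 3 := by
    have := congrArg Fin.val hl
    simpa [labLab] using this
  apply Fin.ext
  rw [← Nat.div_add_mod u.val 3, ← Nat.div_add_mod u'.val 3]
  rw [hb, hq] at h1
  omega

/-! ## §2 Injectivity of the box map -/

/-- **The box map is injective.** [folklore] -/
theorem boxColRow_injective (k c : ℕ) (hk : 1 ≤ k) (_hc : 1 ≤ c)
    {u u' : Fin (3 * (2 ^ c - 1))} {s s' : Fin (5 * k)}
    (h : boxColRow k c u s = boxColRow k c u' s') : u = u' ∧ s = s' := by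
  obtain ⟨hjc, hq, hjq⟩ := labBlock_lt u
  obtain ⟨hjc', hq', hjq'⟩ := labBlock_lt u'
  have hs := s.isLt
  have hs' := s'.isLt
  have hcol := congrArg Prod.fst h
  have hrow := congrArg Prod.snd h
  unfold boxColRow at hcol hrow
  split_ifs at hcol hrow with h1 h2 h2
  · -- triple / triple
    obtain ⟨hjj, hκ⟩ := letterRow_inj hjc hjc' hrow
    -- columns: `3kq + s = 3kq' + s'`
    have hqq : labCopy u = labCopy u' := by
      have e1 : (s.val + 3 * k * labCopy u) / (3 * k) = labCopy u := by
        rw [Nat.add_mul_div_left _ _ (by omega), Nat.div_eq_of_lt h1, zero_add]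
      have e2 : (s'.val + 3 * k * labCopy u') / (3 * k) = labCopy u' := by
        rw [Nat.add_mul_div_left _ _ (by omega), Nat.div_eq_of_lt h2, zero_add]
      have e3 : s.val + 3 * k * labCopy u = s'.val + 3 * k * labCopy u' := by linarith
      rw [e3] at e1
      exact e1.symm.trans e2
    have hss : s.val = s'.val := by rw [hqq] at hcol; omega
    have hl : labLab u = labLab u' := by
      rw [hss] at hκ
      exact (tripleLabNat k s'.val).symm.injective hκ
    exact ⟨lab_eq_of u u' hjj hqq hl, Fin.ext hss⟩
  · -- triple / pair: column ranges differ
    exfalso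
    obtain ⟨hjj, -⟩ := letterRow_inj hjc hjc' hrow
    have hlt : 3 * k * labCopy u + s.val < 3 * k * 2 ^ labBlock u := by nlinarith
    rw [hjj] at hlt
    omega
  · exfalso
    obtain ⟨hjj, -⟩ := letterRow_inj hjc hjc' hrow
    have hlt : 3 * k * labCopy u' + s'.val < 3 * k * 2 ^ labBlock u' := by nlinarith
    rw [← hjj] at hlt
    omega
  · -- pair / pair
    obtain ⟨hjj, hκ⟩ := letterRow_inj hjc hjc' hrow
    have ht : s.val - 3 * k < 2 * k := by omega
    have ht' : s'.val - 3 * k < 2 * k := by omega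
    have hi := pairIdx_lt ht (labLab u)
    have hi' := pairIdx_lt ht' (labLab u')
    rw [hjj] at hcol
    have hcol' : 3 * k * labCopy u + pairIdx k (labLab u) (s.val - 3 * k) =
        3 * k * labCopy u' + pairIdx k (labLab u') (s'.val - 3 * k) := by omega
    have hqq : labCopy u = labCopy u' := by
      have e1 : (pairIdx k (labLab u) (s.val - 3 * k) + 3 * k * labCopy u) / (3 * k) = labCopy u := by
        rw [Nat.add_mul_div_left _ _ (by omega), Nat.div_eq_of_lt hi, zero_add]
      have e2 : (pairIdx k (labLab u') (s'.val - 3 * k) + 3 * k * labCopy u') / (3 * k) =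
          labCopy u' := by
        rw [Nat.add_mul_div_left _ _ (by omega), Nat.div_eq_of_lt hi', zero_add]
      have e3 : pairIdx k (labLab u) (s.val - 3 * k) + 3 * k * labCopy u =
          pairIdx k (labLab u') (s'.val - 3 * k) + 3 * k * labCopy u' := by linarith
      rw [e3] at e1
      exact e1.symm.trans e2
    have hii : pairIdx k (labLab u) (s.val - 3 * k) = pairIdx k (labLab u') (s'.val - 3 * k) := by
      rw [hqq] at hcol'; omega
    have hl : labLab u = labLab u' := eq_of_pairKind_eq ht ht' hii hκ
    rw [hl] at hii
    have htt := pairIdx_inj ht ht' (labLab u') hii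
    exact ⟨lab_eq_of u u' hjj hqq hl, Fin.ext (by omega)⟩

/-! ## §3 Counting the boxes -/

/-- Depth of a column below the full height: `3c - h(n) = 0` for `n < 3k`, else `3 log₂(n/3k) + 1`;
it does not depend on `c`. [folklore] -/
theorem colHeight_add_depth (k c n : ℕ) (hk : 1 ≤ k) (hn : n < 3 * k * 2 ^ c) :
    colHeight k c n + (if n < 3 * k then 0 else 3 * Nat.log 2 (n / (3 * k)) + 1) = 3 * c := by
  unfold colHeight
  split_ifs with h
  · omega
  · have hdiv : n / (3 * k) < 2 ^ c := by
      rw [Nat.div_lt_iff_lt_mul (by omega)]; linarith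
    have hpos : 0 < n / (3 * k) := Nat.div_pos (by omega) (by omega)
    have hlog : Nat.log 2 (n / (3 * k)) < c := (Nat.log_lt_iff_lt_pow (by norm_num) hpos.ne').mpr hdiv
    omega

/-- The total depth over the `3k·2^c` columns: `Σ depth + 15k·2^c = 9kc·2^c + 15k`. [folklore] -/
theorem sum_depth (k : ℕ) (hk : 1 ≤ k) : ∀ c : ℕ,
    (∑ n ∈ Finset.range (3 * k * 2 ^ c),
      (if n < 3 * k then 0 else 3 * Nat.log 2 (n / (3 * k)) + 1)) + 15 * k * 2 ^ c =
      9 * k * c * 2 ^ c + 15 * k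
  | 0 => by
    rw [pow_zero, mul_one, Finset.sum_eq_zero fun n hn => by
      rw [Finset.mem_range] at hn; rw [if_pos hn]]
    ring
  | c + 1 => by
    have ih := sum_depth k hk c
    have hsplit : 3 * k * 2 ^ (c + 1) = 3 * k * 2 ^ c + 3 * k * 2 ^ c := by ring
    rw [hsplit, Finset.sum_range_add]
    have hnew : ∀ n ∈ Finset.range (3 * k * 2 ^ c),
        (if 3 * k * 2 ^ c + n < 3 * k then 0 else 3 * Nat.log 2 ((3 * k * 2 ^ c + n) / (3 * k)) + 1) =
          3 * c + 1 := by
      intro n hn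
      rw [Finset.mem_range] at hn
      have h1 : 1 ≤ 2 ^ c := Nat.one_le_two_pow
      rw [if_neg (by nlinarith)]
      have hdiv : (3 * k * 2 ^ c + n) / (3 * k) = 2 ^ c + n / (3 * k) := by
        rw [show 3 * k * 2 ^ c + n = n + 3 * k * 2 ^ c by ring, Nat.add_mul_div_left _ _ (by omega)]
        ring
      have hlt : n / (3 * k) < 2 ^ c := by
        rw [Nat.div_lt_iff_lt_mul (by omega)]; linarith
      have e1 : 2 ^ c ≤ 2 ^ c + n / (3 * k) := Nat.le_add_right _ _
      have e2 : 2 ^ c + n / (3 * k) < 2 ^ (c + 1) := by rw [pow_succ]; omega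
      have hlog : Nat.log 2 (2 ^ c + n / (3 * k)) = c := Nat.log_eq_of_pow_le_of_lt_pow e1 e2
      rw [hdiv, hlog]
    rw [Finset.sum_congr rfl hnew, Finset.sum_const, Finset.card_range, smul_eq_mul]
    have := ih
    rw [pow_succ]
    nlinarith [ih]

/-- **The diagram has `15k(2^c - 1) = d · m` boxes.** [folklore] -/
theorem sum_colHeight (k c : ℕ) (hk : 1 ≤ k) :
    ∑ n ∈ Finset.range (3 * k * 2 ^ c), colHeight k c n = 3 * (2 ^ c - 1) * (5 * k) := by
  have h1 : ∑ n ∈ Finset.range (3 * k * 2 ^ c), (colHeight k c n +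
      (if n < 3 * k then 0 else 3 * Nat.log 2 (n / (3 * k)) + 1)) = 3 * k * 2 ^ c * (3 * c) := by
    rw [Finset.sum_congr rfl fun n hn => colHeight_add_depth k c n hk (Finset.mem_range.mp hn),
      Finset.sum_const, Finset.card_range, smul_eq_mul]
  rw [Finset.sum_add_distrib] at h1
  have h2 := sum_depth k hk c
  have h3 : 1 ≤ 2 ^ c := Nat.one_le_two_pow
  zify [h3] at h1 h2 ⊢
  nlinarith [h1, h2]

/-! ## §4 The frame -/

variable {σ : Type*}

/-- **The box map of the gadget tableau is a bijection onto its diagram.** [folklore] -/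
theorem gadgetTab_box_bijective (k c : ℕ) (hk : 1 ≤ k) (hc : 1 ≤ c) (x : ℕ → σ) :
    Function.Bijective (fun p : Fin (gadgetTab k c hk hc x).d × Fin (gadgetTab k c hk hc x).m =>
      (gadgetTab k c hk hc x).box p.1 p.2) := by
  classical
  rw [Fintype.bijective_iff_injective_and_card]
  constructor
  · rintro ⟨u, s⟩ ⟨u', s'⟩ h
    have h' := congrArg (fun b : (n : Fin (gadgetTab k c hk hc x).C) × Fin ((gadgetTab k c hk hc x).h n) =>
      (b.1.val, b.2.val)) h
    simp only [gadgetTab, Prod.mk.eta] at h'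
    obtain ⟨hu, hs⟩ := boxColRow_injective k c hk hc (u := u) (u' := u') (s := s) (s' := s')
      (Prod.ext (congrArg Prod.fst h') (congrArg Prod.snd h'))
    rw [hu, hs]
  · rw [Fintype.card_prod, Fintype.card_fin, Fintype.card_fin, Fintype.card_sigma]
    simp only [Fintype.card_fin]
    change 3 * (2 ^ c - 1) * (5 * k) = ∑ n : Fin (3 * k * 2 ^ c), colHeight k c n
    rw [Fin.sum_univ_eq_sum_range (fun n => colHeight k c n) (3 * k * 2 ^ c), sum_colHeight k c hk]

/-- **The frame of the gadget tableau.** [folklore] -/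
def gadgetTabFrame (k c : ℕ) (hk : 1 ≤ k) (hc : 1 ≤ c) (x : ℕ → σ) : (gadgetTab k c hk hc x).Frame where
  boxEquiv := Equiv.ofBijective _ (gadgetTab_box_bijective k c hk hc x)
  box_eq _ _ := rfl

end

end Summit.ValiantsHypothesis.ValiantsHypothesis.Theorems.GeneratorObstructions.PowGenDegreeQP
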